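import Mathlib.RingTheory.Ideal.GoingUp
import Mathlib.RingTheory.Algebraic.Integral
import Mathlib.RingTheory.Localization.FractionRing
import Mathlib.FieldTheory.IsAlgClosed.Basic
import Mathlib.FieldTheory.Galois.Basic
import Literature.NumberTheory.EllipticCurves.CoordinateRingRegular
import Literature.NumberTheory.EllipticCurves.IsogenyDegree
import HarnessLib

/-!
# Translations on the function field `K̄(E)` and `#ker φ ∣ deg φ` (Silverman, *AEC*, III.4.10(b))

Trunk T-ELLARITH (group G16); notion `cm_endomorphisms_isogeny`. Serves the named fact
`Literature.AlgebraicGeometry.Motives.linearIndependent_tateModule_map` of `Literature.AlgebraicGeometry.Motives.FaltingsEC`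
(Silverman, *AEC*, Thm. III.7.4) through the degree route of
`Literature.AlgebraicGeometry.Motives.FaltingsECProofs`
(`Literature.AlgebraicGeometry.Motives.linearIndependent_tateModule_map_of_card_ker_dvd_deg`), which consumes, besides the
finiteness *AEC* II.2.4(a) (proved in `IsogenyDegreeProofs`) and the quadratic form *AEC* III.6.3,
only the divisibility **`#ker φ ∣ deg φ = [K̄(E) : φ^* K̄(E')]`** for isogenies `φ : E → E'` over `K`.
This file **proves** that divisibility for the genuine degree `WeierstrassCurve.Isogeny.deg` of
`Literature.NumberTheory.EllipticCurves.IsogenyDegree`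
(`WeierstrassCurve.Isogeny.card_ker_dvd_deg_holds`), by the Galois-theoretic argument of
Silverman's proof of Thm. III.4.10(b) (book pp. 72–73): the translations `τ_T`, `T ∈ ker φ`, induce
`#ker φ` *distinct* automorphisms `τ_T^*` of `K̄(E)` fixing `φ^* K̄(E')` ("`τ_T^* (φ^* f) =
(φ ∘ τ_T)^* f = φ^* f` since `φ ∘ τ_T = φ`"), so by Artin's theorem (Mathlib's
`FixedPoints.finrank_eq_card`) `#ker φ = [K̄(E) : K̄(E)^{ker φ}]` divides `[K̄(E) : φ^* K̄(E')]`.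
(Silverman obtains the sharper `#ker φ = deg_s φ`, III.4.10(a), from the theory of ramification of
maps of curves, II.2.6, which is not needed here.) Everything is built for the prelude's isogenies
(`Literature.NumberTheory.EllipticCurves.Isogeny`: additive maps on `K̄`-points agreeing with a
rational map off a finite set), so the file first develops the two pieces of function-field
calculus this requires — values of rational functions at points, and the translation
automorphisms `τ_T^*` — as real definitions with their API.

## Contents (all definitions are real)

* `Literature.WeierstrassFunctionField.pointAlgHom V u v h : k[V] →ₐ[k] A` — for a Weierstrass curve `V`
  over any field `k` and a solution `(u, v) ∈ A²` of its equation in a `k`-algebra `A`, the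
  `k`-algebra map `X ↦ u, Y ↦ v` out of the coordinate ring; injective when `u` is transcendental
  (`pointAlgHom_injective`: `k[V]` is a domain integral over `k[X]`), and then
  `funcAlgHom u v h hu : k(V) →ₐ[k] F'` its extension to the function field; the generic
  coordinates `xF V`, `yF V ∈ k(V)` (`evalEval_xF_yF`: they satisfy the equation;
  `transcendental_xF`; `algHom_ext_xy`: a `k`-algebra map out of `k(V)` is determined by its values
  on `x, y`).
* `WeierstrassCurve.HasValueAt W z P c` — **the rational function `z ∈ K̄(E)` is regular at
  `P ∈ E(K̄)` with value `c`**: `z = g(x, y)/h(x, y)` with `h(P) ≠ 0` and `c = g(P)/h(P)`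
  (Silverman, *AEC*, I.§1–II.§1: `K̄[C]_P`, `f(P)`); unique at affine points
  (`HasValueAt.unique`), compatible with `+, *, -, ⁻¹, /` and `MvPolynomial.aeval`, polynomials
  and constants have their obvious values, every `z` is regular off a finite set
  (`exists_finite_hasValueAt`), and **a function vanishing at infinitely many points is `0`**
  (`eq_zero_of_infinite_setOf_hasValueAt_zero`, *AEC* II.1.2; from the tree's
  `WeierstrassCurve.evalGeneric_eq_zero_of_infinite`), whence `eq_of_infinite_setOf_hasValueAt`.
* `WeierstrassCurve.genX W, genY W ∈ K̄(E)`, `genericPoint W = (x, y) ∈ E(K̄(E))` (a Mathlib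
  `Affine.Point` of `E` over `K̄(E)`), `constPoint W : E(K̄) →+ E(K̄(E))` (Mathlib's
  `Affine.Point.map` along `K̄ → K̄(E)`); an affine point of `E(K̄(E))` with algebraic
  `x`-coordinate is constant (`exists_constPoint_eq_of_isAlgebraic`), and `(x, y) + T` is never
  constant (`genericPoint_add_constPoint_ne`).
* `WeierstrassCurve.transAlgHom W T : K̄(E) →ₐ[K̄] K̄(E)` — **the translation `τ_T^*`**, defined as
  the (unique, `algHom_eq_of_map_genericPoint_eq`) `K̄`-algebra endomorphism mapping the generic
  point to `(x, y) + T` (`map_transAlgHom_genericPoint`; it exists as the `funcAlgHom` of that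
  point, `exists_algHom_map_genericPoint_eq`). From the uniqueness and the additivity of Mathlib's
  `Affine.Point.map`: **`τ_O^* = id`, `τ_{S+T}^* = τ_S^* ∘ τ_T^*`** (`transAlgHom_zero`,
  `transAlgHom_add`), so `transAlgEquiv W T : K̄(E) ≃ₐ[K̄] K̄(E)` and the **injective** homomorphism
  `transHom W : E(K̄) → Aut(K̄(E)/K̄)` (`transHom_injective`: `τ_T^* = id` forces
  `(x, y) + T = (x, y)`).
* **`(τ_T^* z)(P) = z(P + T)`** (`HasValueAt.transAlgHom`, for `P ≠ O, T, -T`): the chord through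
  `(x, y)` and `T` over `K̄(E)` specialises to the chord through `P` and `T`
  (`hasValueAt_transAlgHom_gen`, Mathlib's `Affine.Point.add_of_X_ne` over both fields).
* `WeierstrassCurve.Isogeny.transAlgHom_pullbackX/Y`: for `T ∈ ker φ`, `τ_T^*` fixes `φ^* x'` and
  `φ^* y'` (they and their translates have the value `x'(φ(P + T)) = x'(φ P)` at almost every `P`);
  `Isogeny.pullbackField_le_fixedField`; and the target
  **`WeierstrassCurve.Isogeny.card_ker_dvd_deg_holds : Nat.card (ker φ) ∣ φ.deg`**.

## Faithfulness of the encoding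

`τ_T^*` is Silverman's automorphism of `K̄(E₁)` induced by the translation `τ_T : P ↦ P + T`
(III.4.7, III.4.10(b)): a rational map `E ⇢ E` over `K̄` is the same as a point of `E(K̄(E))`
(its generic value), the induced map on function fields is the `K̄`-algebra map sending `(x, y)` to
that point, and for `τ_T` the generic value is `(x, y) + T` computed by the group law over the field
`K̄(E)` (Silverman, proof of III.6.2(c), uses the same device: "`(x₁, y₁) ∈ E₁(K(x₁, y₁))`").
The dictionary with values at points (`HasValueAt.transAlgHom`) confirms that `τ_T^* z = z ∘ τ_T`
wherever both sides are defined. `HasValueAt` is the elementary form of "`z ∈ K̄[E]_P` and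
`z(P) = c`" (I.§1); it is only used at affine points, where it is single-valued.

## Mathlib

Used: the group law on `Affine.Point` over any field and its functoriality `Affine.Point.map`
(`map_baseChange`, `map_injective`, `add_of_X_ne`), `Affine.CoordinateRing`/`FunctionField`,
`Polynomial.aevalAeval`, `IsFractionRing.liftAlgHom`, `Ideal.eq_bot_of_comap_eq_bot`,
`IntermediateField.fixedField`, `FixedPoints.finrank_eq_card` (Artin),
`IntermediateField.finrank_dvd_of_le_left`. Mathlib has no generic point, translation
automorphisms or evaluation of rational functions at points of a Weierstrass curve (searched
`Mathlib/AlgebraicGeometry/EllipticCurve` for `FunctionField`, `generic`, `translation`).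

## References

* [SilvermanAEC2009] J. H. Silverman, *The Arithmetic of Elliptic Curves*, 2nd ed., GTM 106,
  Springer 2009: I.§1 and II.§1 (regular functions, values, II.1.2), II.§2 (`φ^*`), III.2.3
  (group law formulas), III.3.6 and III.4.7 (translations), **Thm. III.4.10 and its proof,
  pp. 72–73** (`T ↦ τ_T^*` is an injective homomorphism `ker φ → Aut(K̄(E₁)/φ^* K̄(E₂))`),
  proof of Thm. III.6.2(c) (the point `(x₁, y₁) ∈ E₁(K(x₁, y₁))`).
* E. Artin, *Galois Theory* (1944), Thm. 14 (`[F : F^G] = |G|`), as `FixedPoints.finrank_eq_card`.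

## Design choices

* `noncomputable section`, `open scoped Classical`, `K : Type u`, dot-notation extensions in
  `namespace WeierstrassCurve` and the generic part in `namespace Literature.WeierstrassFunctionField`
  (as in `IsogenyDegreeProofs`), everything over `K̄ = AlgebraicClosure K` like the preludes.
* `transAlgHom` is defined by choice from its characterisation (`map_transAlgHom_genericPoint`)
  rather than by an explicit chord formula, so that `τ_O^*` needs no separate case and all
  identities follow from uniqueness; the chord formula enters only in the value computation.
* No finiteness of `K̄(E)/φ^* K̄(E')` is used: `finrank_dvd_of_le_left` is unconditional.
-/

noncomputable section

open scoped Classical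
open scoped Polynomial.Bivariate
open Polynomial

universe u v

/-! ## `k`-algebra maps out of `k[V]` and `k(V)` from points -/

namespace Literature.NumberTheory.EllipticCurves.WeierstrassFunctionField

variable {k : Type u} [Field k] (V : WeierstrassCurve.Affine k)
variable {A : Type v} [CommRing A] [Algebra k A]

/-- The two-variable polynomial `p ∈ k[X][Y]` evaluated at `(u, v) ∈ A²` (`A` a `k`-algebra):
Mathlib's `aevalAeval u v p` is `evalEval u v` of `p` with coefficients mapped to `A`. [folklore] -/
theorem aevalAeval_eq_evalEval_map (u v : A) (p : k[X][Y]) :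
    aevalAeval u v p = (p.map (mapRingHom (algebraMap k A))).evalEval u v := by
  rw [← eval₂_eval₂RingHom_apply]
  change (aevalAeval u v : k[X][Y] →ₐ[k] A).toRingHom p = (eval₂RingHom (eval₂RingHom _ u) v) p
  congr 1
  refine Polynomial.ringHom_ext' ?_ ?_
  · refine Polynomial.ringHom_ext' ?_ ?_
    · ext c
      simp
    · simp
  · simp

/-- `aevalAeval u v` on `k[X][Y]` is `MvPolynomial.aeval ![u, v]` through Mathlib's identification
`k[X][Y] ≃ MvPolynomial (Fin 2) k` (variable `0` is `X`, variable `1` is `Y`). [folklore] -/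
theorem aevalAeval_equivMvPolynomial_symm (u v : A) (g : MvPolynomial (Fin 2) k) :
    aevalAeval u v ((Bivariate.equivMvPolynomial k).symm g) = MvPolynomial.aeval ![u, v] g := by
  change ((aevalAeval u v).comp
    ((Bivariate.equivMvPolynomial k).symm : MvPolynomial (Fin 2) k →ₐ[k] k[X][Y])) g = _
  congr 1
  refine MvPolynomial.algHom_ext fun i ↦ ?_
  fin_cases i
  · simp [Bivariate.equivMvPolynomial_symm_X_0]
  · simp [Bivariate.equivMvPolynomial_symm_X_1]

/-- **The point map `k[V] → A` of a solution `(u, v) ∈ A²` of the Weierstrass equation**: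
the `k`-algebra map `X ↦ u`, `Y ↦ v` (`k[V] = k[X][Y]/(W(X, Y))`). For `A = k` and `(u, v)` a
point of `V(k)` this is evaluation of regular functions at the point; for `A = k(V)` it gives the
endomorphisms of the function field used below. Silverman, *AEC*, I.§1, II.§1. [folklore] -/
def pointAlgHom (u v : A) (h : (V.polynomial.map (mapRingHom (algebraMap k A))).evalEval u v = 0) :
    V.CoordinateRing →ₐ[k] A :=
  Ideal.Quotient.liftₐ (Ideal.span {V.polynomial}) (aevalAeval u v) (by
    intro a ha
    obtain ⟨b, rfl⟩ := Ideal.mem_span_singleton'.mp ha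
    rw [map_mul, aevalAeval_eq_evalEval_map (p := V.polynomial), h, mul_zero])

variable {V}

/-- The point map on the class of `p ∈ k[X][Y]` is `p(u, v)`. [folklore] -/
theorem pointAlgHom_mk (u v : A) (h) (p : k[X][Y]) :
    pointAlgHom V u v h (WeierstrassCurve.Affine.CoordinateRing.mk V p) =
      (p.map (mapRingHom (algebraMap k A))).evalEval u v := by
  rw [← aevalAeval_eq_evalEval_map]
  rfl

/-- The point map on (the class of) `p ∈ k[X]` is `p(u)`. [folklore] -/
theorem pointAlgHom_algebraMap (u v : A) (h) (p : k[X]) :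
    pointAlgHom V u v h (algebraMap k[X] V.CoordinateRing p) = aeval u p := by
  rw [← aevalAeval_C u v]
  rfl

/-- The point map sends (the class of) `Y` to `v`. [folklore] -/
theorem pointAlgHom_mk_Y (u v : A) (h) :
    pointAlgHom V u v h (WeierstrassCurve.Affine.CoordinateRing.mk V Y) = v := by
  rw [pointAlgHom_mk, ← aevalAeval_eq_evalEval_map, aevalAeval_Y]

/-- **If `u` is transcendental over `k` (and `A` is a domain), the point map `k[V] → A` is
injective**: its kernel is a prime ideal of the domain `k[V]`, integral over `k[X]`, meeting
`k[X]` in `0`. [folklore] -/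
theorem pointAlgHom_injective [IsDomain A] {u v : A} (h) (hu : Transcendental k u) :
    Function.Injective (pointAlgHom V u v h) := by
  rw [injective_iff_map_eq_zero]
  intro a ha
  have hP : RingHom.ker (pointAlgHom V u v h).toRingHom = ⊥ := by
    haveI : (RingHom.ker (pointAlgHom V u v h).toRingHom).IsPrime := RingHom.ker_isPrime _
    refine Ideal.eq_bot_of_comap_eq_bot (R := k[X]) ?_
    rw [eq_bot_iff]
    intro p hp
    rw [Ideal.mem_comap, RingHom.mem_ker, AlgHom.toRingHom_eq_coe, RingHom.coe_coe,
      pointAlgHom_algebraMap] at hp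
    rw [Ideal.mem_bot]
    exact (transcendental_iff_injective.mp hu) (by rwa [map_zero])
  have : a ∈ RingHom.ker (pointAlgHom V u v h).toRingHom := ha
  rwa [hP, Ideal.mem_bot] at this

variable (V) in
/-- The generic `x`-coordinate `x ∈ k(V)`. [folklore] -/
def xF : V.FunctionField := algebraMap k[X] V.FunctionField X

variable (V) in
/-- The generic `y`-coordinate `y ∈ k(V)`. [folklore] -/
def yF : V.FunctionField :=
  algebraMap V.CoordinateRing V.FunctionField (WeierstrassCurve.Affine.CoordinateRing.mk V Y)

/-- `k[V] → k(V)` is evaluation at the generic point `(x, y)`. [folklore] -/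
theorem algebraMap_mk (p : k[X][Y]) :
    algebraMap V.CoordinateRing V.FunctionField (WeierstrassCurve.Affine.CoordinateRing.mk V p) =
      aevalAeval (xF V) (yF V) p := by
  change ((IsScalarTower.toAlgHom k V.CoordinateRing V.FunctionField).comp
    (Ideal.Quotient.mkₐ k _)) p = _
  congr 1
  refine Polynomial.algHom_ext' (Polynomial.algHom_ext ?_) ?_
  · change algebraMap V.CoordinateRing V.FunctionField (algebraMap k[X] V.CoordinateRing X) =
      aevalAeval (xF V) (yF V) (C X)
    rw [aevalAeval_X, ← IsScalarTower.algebraMap_apply]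
    rfl
  · change algebraMap V.CoordinateRing V.FunctionField
      (WeierstrassCurve.Affine.CoordinateRing.mk V Y) = aevalAeval (xF V) (yF V) Y
    rw [aevalAeval_Y]
    rfl

variable (V) in
/-- **The generic point satisfies the Weierstrass equation.** [folklore] -/
theorem evalEval_xF_yF :
    (V.polynomial.map (mapRingHom (algebraMap k V.FunctionField))).evalEval (xF V) (yF V) = 0 := by
  rw [← aevalAeval_eq_evalEval_map, ← algebraMap_mk]
  change algebraMap V.CoordinateRing V.FunctionField (AdjoinRoot.mk V.polynomial V.polynomial) = 0
  rw [AdjoinRoot.mk_self, map_zero]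

variable (V) in
/-- **`x ∈ k(V)` is transcendental over `k`** (`k[x] → k[V] → k(V)` is injective).
Silverman, *AEC*, II.§1. [folklore] -/
theorem transcendental_xF : Transcendental k (xF V) := by
  rw [transcendental_iff_injective]
  have h : ∀ p : k[X], aeval (xF V) p = algebraMap k[X] V.FunctionField p := fun p ↦ by
    rw [xF, show algebraMap k[X] V.FunctionField X =
      (IsScalarTower.toAlgHom k k[X] V.FunctionField) X from rfl, aeval_algHom_apply,
      aeval_X_left_apply]
    rfl
  intro p q hpq
  rw [h, h] at hpq
  rw [IsScalarTower.algebraMap_eq k[X] V.CoordinateRing] at hpq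
  exact Literature.NumberTheory.EllipticCurves.WeierstrassCoordinateRing.algebraMap_injective V
    ((IsFractionRing.injective V.CoordinateRing V.FunctionField) hpq)

variable {F' : Type v} [Field F'] [Algebra k F']

/-- A `k`-algebra map out of `k(V)` commutes with two-variable evaluation. [folklore] -/
theorem algHom_aevalAeval (σ : V.FunctionField →ₐ[k] F') (x y : V.FunctionField) (p : k[X][Y]) :
    σ (aevalAeval x y p) = aevalAeval (σ x) (σ y) p := by
  change (σ.comp (aevalAeval x y)) p = _
  congr 1
  refine Polynomial.algHom_ext' (Polynomial.algHom_ext ?_) ?_ <;> simp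

/-- **Two `k`-algebra maps out of `k(V)` agreeing on `x` and `y` are equal** (`k(V)` is the
fraction field of `k[V] = k[x, y]`). [folklore] -/
theorem algHom_ext_xy {σ τ : V.FunctionField →ₐ[k] F'} (hx : σ (xF V) = τ (xF V))
    (hy : σ (yF V) = τ (yF V)) : σ = τ := by
  have hR : ∀ a : V.CoordinateRing, σ (algebraMap _ _ a) = τ (algebraMap _ _ a) := by
    intro a
    obtain ⟨p, rfl⟩ := Ideal.Quotient.mk_surjective a
    change σ (algebraMap _ _ (WeierstrassCurve.Affine.CoordinateRing.mk V p)) =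
      τ (algebraMap _ _ (WeierstrassCurve.Affine.CoordinateRing.mk V p))
    rw [algebraMap_mk, algHom_aevalAeval, algHom_aevalAeval, hx, hy]
  apply AlgHom.coe_ringHom_injective
  exact IsFractionRing.ringHom_ext (A := V.CoordinateRing) hR

/-- **An algebra map `σ` out of `k(V)` gives the point `(σ x, σ y)` of `V`.** [folklore] -/
theorem evalEval_algHom (σ : V.FunctionField →ₐ[k] F') :
    (V.polynomial.map (mapRingHom (algebraMap k F'))).evalEval (σ (xF V)) (σ (yF V)) = 0 := by
  have := congrArg σ (evalEval_xF_yF V)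
  rw [map_zero, ← aevalAeval_eq_evalEval_map, algHom_aevalAeval] at this
  rwa [← aevalAeval_eq_evalEval_map]

/-- **The `k`-algebra map `k(V) → F'` of a point `(u, v) ∈ V(F')` with `u` transcendental over
`k`**: the extension to the fraction field of the (injective) point map `k[V] → F'`. With
`F' = k(V)` these are the pull-backs along rational maps `V ⇢ V`; the translations below are of
this form. Silverman, *AEC*, II.§2 (`φ^* : K(C₂) → K(C₁)`). [folklore] -/
def funcAlgHom (u v : F') (h : (V.polynomial.map (mapRingHom (algebraMap k F'))).evalEval u v = 0)
    (hu : Transcendental k u) : V.FunctionField →ₐ[k] F' :=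
  IsFractionRing.liftAlgHom (K := V.FunctionField) (pointAlgHom_injective h hu)

/-- `funcAlgHom` extends the point map. [folklore] -/
theorem funcAlgHom_algebraMap (u v : F') (h) (hu : Transcendental k u) (a : V.CoordinateRing) :
    funcAlgHom u v h hu (algebraMap V.CoordinateRing V.FunctionField a) = pointAlgHom V u v h a := by
  rw [funcAlgHom, IsFractionRing.liftAlgHom_apply, IsFractionRing.lift_algebraMap]
  rfl

/-- `funcAlgHom u v` sends `x ↦ u`. [folklore] -/
theorem funcAlgHom_xF (u v : F') (h) (hu : Transcendental k u) : funcAlgHom u v h hu (xF V) = u := by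
  rw [xF, IsScalarTower.algebraMap_apply k[X] V.CoordinateRing V.FunctionField,
    funcAlgHom_algebraMap, pointAlgHom_algebraMap, aeval_X]

/-- `funcAlgHom u v` sends `y ↦ v`. [folklore] -/
theorem funcAlgHom_yF (u v : F') (h) (hu : Transcendental k u) : funcAlgHom u v h hu (yF V) = v := by
  rw [yF, funcAlgHom_algebraMap, pointAlgHom_mk_Y]

end Literature.NumberTheory.EllipticCurves.WeierstrassFunctionField

namespace WeierstrassCurve

open geomPoints Literature.NumberTheory.EllipticCurves.WeierstrassFunctionField

variable {K : Type u} [Field K] {W W' : WeierstrassCurve K}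

/-! ## Values of rational functions at points of `E(K̄)` -/

section Values

variable (W) in
/-- **The value of a rational function at a point.** `W.HasValueAt z P c` says that the element
`z` of the function field `K̄(E)` is *regular at the point `P ∈ E(K̄)` with value `c ∈ K̄`*:
`z = g(x, y)/h(x, y)` for two-variable polynomials `g, h` with `h(P) ≠ 0` and `c = g(P)/h(P)`
(written multiplicatively). For an affine point `P` the value is unique (`HasValueAt.unique`); at
`P = O` (whose "coordinates" `xy O` are a junk value) the predicate is not used.
Silverman, *AEC*, I.§1 and II.§1 (`K̄[C]_P`, "`f` is regular at `P`", `f(P)`). [folklore] -/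
def HasValueAt (z : W.geomFunctionField) (P : W.geomPoints) (c : AlgebraicClosure K) : Prop :=
  ∃ g h : MvPolynomial (Fin 2) (AlgebraicClosure K), MvPolynomial.eval (xy P) h ≠ 0 ∧
    z * W.evalGeneric h = W.evalGeneric g ∧
      MvPolynomial.eval (xy P) g = c * MvPolynomial.eval (xy P) h

variable {z w : W.geomFunctionField} {P : W.geomPoints} {c d : AlgebraicClosure K}

/-- `g(x, y)/h(x, y)` (given as `z` with `z · h(x, y) = g(x, y)`) has value `g(P)/h(P)` at `P`
when `h(P) ≠ 0`. [folklore] -/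
theorem hasValueAt_of_mul_eq {g h : MvPolynomial (Fin 2) (AlgebraicClosure K)}
    (hh : MvPolynomial.eval (xy P) h ≠ 0) (hz : z * W.evalGeneric h = W.evalGeneric g) :
    W.HasValueAt z P (MvPolynomial.eval (xy P) g / MvPolynomial.eval (xy P) h) :=
  ⟨g, h, hh, hz, by rw [div_mul_cancel₀ _ hh]⟩

/-- `g(x, y)/h(x, y)` has value `g(P)/h(P)` at an affine `P` with `h(P) ≠ 0`. [folklore] -/
theorem hasValueAt_div (hP : P ≠ 0) {g h : MvPolynomial (Fin 2) (AlgebraicClosure K)}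
    (hh : MvPolynomial.eval (xy P) h ≠ 0) :
    W.HasValueAt (W.evalGeneric g / W.evalGeneric h) P
      (MvPolynomial.eval (xy P) g / MvPolynomial.eval (xy P) h) :=
  hasValueAt_of_mul_eq hh (div_mul_cancel₀ _ (evalGeneric_ne_zero_of_eval_ne_zero hP hh))

/-- A polynomial `g(x, y)` has value `g(P)` at `P`. [folklore] -/
theorem hasValueAt_evalGeneric (g : MvPolynomial (Fin 2) (AlgebraicClosure K)) (P : W.geomPoints) :
    W.HasValueAt (W.evalGeneric g) P (MvPolynomial.eval (xy P) g) :=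
  ⟨g, 1, by simp, by simp, by simp⟩

/-- A constant `c` has value `c`. [folklore] -/
theorem hasValueAt_algebraMap (c : AlgebraicClosure K) (P : W.geomPoints) :
    W.HasValueAt (algebraMap (AlgebraicClosure K) W.geomFunctionField c) P c := by
  simpa [evalGeneric_C] using hasValueAt_evalGeneric (W := W) (MvPolynomial.C c) P

/-- `0` has value `0`. [folklore] -/
theorem hasValueAt_zero (P : W.geomPoints) : W.HasValueAt 0 P 0 := by
  simpa using hasValueAt_evalGeneric (W := W) 0 P

/-- `1` has value `1`. [folklore] -/
theorem hasValueAt_one (P : W.geomPoints) : W.HasValueAt 1 P 1 := by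
  simpa using hasValueAt_evalGeneric (W := W) 1 P

/-- **The value at an affine point is unique** (cross-multiply and use that a polynomial vanishing
in `K̄(E)` vanishes at every affine point, `eval_xy_eq_zero_of_evalGeneric_eq_zero`).
Silverman, *AEC*, II.§1. [folklore] -/
theorem HasValueAt.unique (hP : P ≠ 0) (h₁ : W.HasValueAt z P c) (h₂ : W.HasValueAt z P d) :
    c = d := by
  obtain ⟨g, h, hh, hz, hg⟩ := h₁
  obtain ⟨g', h', hh', hz', hg'⟩ := h₂
  have h0 : W.evalGeneric (g * h' - g' * h) = 0 := by
    rw [map_sub, map_mul, map_mul, ← hz, ← hz']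
    ring
  have := eval_xy_eq_zero_of_evalGeneric_eq_zero h0 hP
  rw [map_sub, map_mul, map_mul, hg, hg'] at this
  have h3 : (c - d) * (MvPolynomial.eval (xy P) h * MvPolynomial.eval (xy P) h') = 0 := by
    linear_combination this
  exact sub_eq_zero.mp ((mul_eq_zero.mp h3).resolve_right (mul_ne_zero hh hh'))

/-- Values add. [folklore] -/
theorem HasValueAt.add (h₁ : W.HasValueAt z P c) (h₂ : W.HasValueAt w P d) :
    W.HasValueAt (z + w) P (c + d) := by
  obtain ⟨g, h, hh, hz, hg⟩ := h₁
  obtain ⟨g', h', hh', hz', hg'⟩ := h₂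
  refine ⟨g * h' + g' * h, h * h', by rw [map_mul]; exact mul_ne_zero hh hh', ?_, ?_⟩
  · rw [map_mul, map_add, map_mul, map_mul, ← hz, ← hz']
    ring
  · simp only [map_add, map_mul, hg, hg']
    ring

/-- Values multiply. [folklore] -/
theorem HasValueAt.mul (h₁ : W.HasValueAt z P c) (h₂ : W.HasValueAt w P d) :
    W.HasValueAt (z * w) P (c * d) := by
  obtain ⟨g, h, hh, hz, hg⟩ := h₁
  obtain ⟨g', h', hh', hz', hg'⟩ := h₂
  refine ⟨g * g', h * h', by rw [map_mul]; exact mul_ne_zero hh hh', ?_, ?_⟩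
  · rw [map_mul, map_mul, ← hz, ← hz']
    ring
  · simp only [map_mul, hg, hg']
    ring

/-- Values negate. [folklore] -/
theorem HasValueAt.neg (h₁ : W.HasValueAt z P c) : W.HasValueAt (-z) P (-c) := by
  obtain ⟨g, h, hh, hz, hg⟩ := h₁
  exact ⟨-g, h, hh, by rw [map_neg, ← hz]; ring, by rw [map_neg, hg]; ring⟩

/-- Values subtract. [folklore] -/
theorem HasValueAt.sub (h₁ : W.HasValueAt z P c) (h₂ : W.HasValueAt w P d) :
    W.HasValueAt (z - w) P (c - d) := by
  simpa only [sub_eq_add_neg] using h₁.add h₂.neg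

/-- Values of powers. [folklore] -/
theorem HasValueAt.pow (h₁ : W.HasValueAt z P c) (n : ℕ) : W.HasValueAt (z ^ n) P (c ^ n) := by
  induction n with
  | zero => simpa using hasValueAt_one (W := W) P
  | succ n ih => simpa only [pow_succ] using ih.mul h₁

/-- A function with a non-zero value at an affine point is non-zero. [folklore] -/
theorem HasValueAt.ne_zero (hP : P ≠ 0) (h₁ : W.HasValueAt z P c) (hc : c ≠ 0) : z ≠ 0 := by
  rintro rfl
  exact hc (h₁.unique hP (hasValueAt_zero P) ▸ rfl)

/-- The value of `0` at an affine point is `0`. [folklore] -/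
theorem HasValueAt.eq_zero (hP : P ≠ 0) (h₁ : W.HasValueAt 0 P c) : c = 0 :=
  h₁.unique hP (hasValueAt_zero P)

/-- Values invert (at an affine point, for a non-zero value). [folklore] -/
theorem HasValueAt.inv (hP : P ≠ 0) (h₁ : W.HasValueAt z P c) (hc : c ≠ 0) :
    W.HasValueAt z⁻¹ P c⁻¹ := by
  have hz0 : z ≠ 0 := h₁.ne_zero hP hc
  obtain ⟨g, h, hh, hz, hg⟩ := h₁
  have hg0 : MvPolynomial.eval (xy P) g ≠ 0 := by
    rw [hg]; exact mul_ne_zero hc hh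
  refine ⟨h, g, hg0, ?_, ?_⟩
  · rw [← hz, inv_mul_cancel_left₀ hz0]
  · rw [hg]
    field_simp

/-- Values divide (at an affine point, for a non-zero denominator value). [folklore] -/
theorem HasValueAt.div (hP : P ≠ 0) (h₁ : W.HasValueAt z P c) (h₂ : W.HasValueAt w P d)
    (hd : d ≠ 0) : W.HasValueAt (z / w) P (c / d) := by
  rw [div_eq_mul_inv, div_eq_mul_inv]
  exact h₁.mul (h₂.inv hP hd)

/-- Transport of a value along equalities. [folklore] -/
theorem HasValueAt.congr (h₁ : W.HasValueAt z P c) (hz : z = w) (hc : c = d) :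
    W.HasValueAt w P d :=
  hz ▸ hc ▸ h₁

/-- Every rational function is a quotient of polynomials in the Weierstrass coordinates.
[folklore] -/
theorem exists_eq_evalGeneric_div (z : W.geomFunctionField) :
    ∃ g h : MvPolynomial (Fin 2) (AlgebraicClosure K),
      W.evalGeneric h ≠ 0 ∧ z = W.evalGeneric g / W.evalGeneric h := by
  obtain ⟨a, b, hb, rfl⟩ := IsFractionRing.div_surjective
    (A := (W.baseChange (AlgebraicClosure K)).toAffine.CoordinateRing) z
  obtain ⟨pa, rfl⟩ := Ideal.Quotient.mk_surjective a
  obtain ⟨pb, rfl⟩ := Ideal.Quotient.mk_surjective b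
  refine ⟨Bivariate.equivMvPolynomial _ pa, Bivariate.equivMvPolynomial _ pb, ?_, ?_⟩
  · rw [evalGeneric_apply, AlgEquiv.symm_apply_apply]
    exact fun h0 ↦ nonZeroDivisors.ne_zero hb ((FaithfulSMul.algebraMap_injective _ _)
      (h0.trans (map_zero _).symm))
  · simp only [evalGeneric_apply, AlgEquiv.symm_apply_apply]
    rfl

/-- The affine zeros of a polynomial non-zero in `K̄(E)` form a finite set. [folklore] -/
theorem finite_setOf_eval_xy_eq_zero {h : MvPolynomial (Fin 2) (AlgebraicClosure K)}
    (hh : W.evalGeneric h ≠ 0) :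
    {P : W.geomPoints | P ≠ 0 ∧ MvPolynomial.eval (xy P) h = 0}.Finite :=
  Set.not_infinite.mp fun hinf ↦ hh (evalGeneric_eq_zero_of_infinite hinf)

/-- **A rational function is regular at all but finitely many points.** Silverman, *AEC*, II.§1
(finitely many poles). [folklore] -/
theorem exists_finite_hasValueAt (z : W.geomFunctionField) :
    ∃ S : Set W.geomPoints, S.Finite ∧ ∀ P ∉ S, P ≠ 0 → ∃ c, W.HasValueAt z P c := by
  obtain ⟨g, h, hh, rfl⟩ := exists_eq_evalGeneric_div z
  refine ⟨_, finite_setOf_eval_xy_eq_zero hh, fun P hP hP0 ↦ ⟨_, hasValueAt_div hP0 ?_⟩⟩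
  simpa [hP0] using hP

/-- **A rational function vanishing at infinitely many points is zero** (`z = g/h`; off the
finitely many zeros of `h`, a zero of `z` is a zero of `g`, and a polynomial with infinitely many
zeros on `E(K̄)` vanishes in `K̄(E)`). Silverman, *AEC*, II.1.2. [folklore] -/
theorem eq_zero_of_infinite_setOf_hasValueAt_zero
    (hz : {P : W.geomPoints | P ≠ 0 ∧ W.HasValueAt z P 0}.Infinite) : z = 0 := by
  obtain ⟨g, h, hh, rfl⟩ := exists_eq_evalGeneric_div z
  suffices hg : W.evalGeneric g = 0 by rw [hg, zero_div]
  apply evalGeneric_eq_zero_of_infinite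
  refine (hz.sdiff (finite_setOf_eval_xy_eq_zero hh)).mono ?_
  rintro P ⟨⟨hP0, hP⟩, hPh⟩
  have hPh' : MvPolynomial.eval (xy P) h ≠ 0 := by simpa [hP0] using hPh
  refine ⟨hP0, ?_⟩
  have := (hasValueAt_div hP0 hPh' (g := g)).unique hP0 hP
  simpa [hPh'] using this

/-- **Two rational functions with the same value at infinitely many points are equal.**
[folklore] -/
theorem eq_of_infinite_setOf_hasValueAt
    (h : {P : W.geomPoints | P ≠ 0 ∧ ∃ c, W.HasValueAt z P c ∧ W.HasValueAt w P c}.Infinite) :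
    z = w := by
  rw [← sub_eq_zero]
  apply eq_zero_of_infinite_setOf_hasValueAt_zero
  refine h.mono ?_
  rintro P ⟨hP0, c, hz, hw⟩
  exact ⟨hP0, by simpa using hz.sub hw⟩

end Values

/-! ## The generic point and the constant points of `E(K̄(E))` -/

section Generic

variable (W)

/-- The generic `x`-coordinate `x ∈ K̄(E)`. [folklore] -/
abbrev genX : W.geomFunctionField := xF (W.baseChange (AlgebraicClosure K)).toAffine

/-- The generic `y`-coordinate `y ∈ K̄(E)`. [folklore] -/
abbrev genY : W.geomFunctionField := yF (W.baseChange (AlgebraicClosure K)).toAffine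

variable {W} in
/-- Evaluation at the generic point is `MvPolynomial.aeval` at `(x, y)`. [folklore] -/
theorem evalGeneric_eq_aeval (g : MvPolynomial (Fin 2) (AlgebraicClosure K)) :
    W.evalGeneric g = MvPolynomial.aeval ![W.genX, W.genY] g := by
  rw [evalGeneric_apply, Literature.NumberTheory.EllipticCurves.WeierstrassFunctionField.algebraMap_mk, aevalAeval_equivMvPolynomial_symm]

variable {W} in
/-- `x = X₀(x, y)`. [folklore] -/
@[simp] theorem evalGeneric_X_zero : W.evalGeneric (MvPolynomial.X 0) = W.genX := by
  simp [evalGeneric_eq_aeval]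

variable {W} in
/-- `y = X₁(x, y)`. [folklore] -/
@[simp] theorem evalGeneric_X_one : W.evalGeneric (MvPolynomial.X 1) = W.genY := by
  simp [evalGeneric_eq_aeval]

/-- `x ∈ K̄(E)` is transcendental over `K̄`. [folklore] -/
theorem transcendental_genX : Transcendental (AlgebraicClosure K) W.genX :=
  transcendental_xF _

variable {W} in
/-- A `K̄`-algebra map out of `K̄(E)` acts on `g(x, y)` by `g ↦ g(σ x, σ y)`. [folklore] -/
theorem algHom_evalGeneric {F' : Type u} [Field F'] [Algebra (AlgebraicClosure K) F']
    (σ : W.geomFunctionField →ₐ[AlgebraicClosure K] F')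
    (g : MvPolynomial (Fin 2) (AlgebraicClosure K)) :
    σ (W.evalGeneric g) = MvPolynomial.aeval ![σ W.genX, σ W.genY] g := by
  have : (fun i ↦ σ (![W.genX, W.genY] i)) = ![σ W.genX, σ W.genY] := by
    funext i
    fin_cases i <;> rfl
  rw [evalGeneric_eq_aeval, ← AlgHom.comp_apply, MvPolynomial.comp_aeval, this]

/-- The Weierstrass polynomial of `E` over `K̄(E)` is that of `E` over `K̄` with coefficients
mapped. [folklore] -/
theorem baseChange_geomFunctionField_polynomial :
    (W.baseChange W.geomFunctionField).toAffine.polynomial =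
      (W.baseChange (AlgebraicClosure K)).toAffine.polynomial.map
        (mapRingHom (algebraMap (AlgebraicClosure K) W.geomFunctionField)) :=
  Affine.baseChange_polynomial (W := W)
    (f := Algebra.ofId (AlgebraicClosure K) W.geomFunctionField)

/-- **The generic point `(x, y)` satisfies the equation of `E`.** [folklore] -/
theorem equation_genX_genY : (W.baseChange W.geomFunctionField).toAffine.Equation W.genX W.genY := by
  rw [Affine.Equation, baseChange_geomFunctionField_polynomial]
  exact evalEval_xF_yF _

/-- The generic point is nonsingular (`E` is elliptic). [folklore] -/
theorem nonsingular_genX_genY [W.IsElliptic] :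
    (W.baseChange W.geomFunctionField).toAffine.Nonsingular W.genX W.genY :=
  (Affine.equation_iff_nonsingular (W := W.baseChange W.geomFunctionField)).mp
    (equation_genX_genY W)

/-- **The generic point `(x, y) ∈ E(K̄(E))`.** Silverman, *AEC*, proof of Thm. III.6.2(c)
(the point `(x₁, y₁) ∈ E₁(K(x₁, y₁))`). [folklore] -/
def genericPoint [W.IsElliptic] : (W.baseChange W.geomFunctionField).toAffine.Point :=
  .some W.genX W.genY (nonsingular_genX_genY W)

/-- **The constant points**: the inclusion `E(K̄) → E(K̄(E))` (base change of points along
`K̄ → K̄(E)`, Mathlib's `Affine.Point.map`). [folklore] -/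
def constPoint : W.geomPoints →+ (W.baseChange W.geomFunctionField).toAffine.Point :=
  Affine.Point.map (W' := W) (Algebra.ofId (AlgebraicClosure K) W.geomFunctionField)

variable {W}

/-- The constant point of an affine point. [folklore] -/
theorem constPoint_some {a b : AlgebraicClosure K}
    (h : (W.baseChange (AlgebraicClosure K)).toAffine.Nonsingular a b) :
    W.constPoint (.some a b h) = .some (algebraMap _ W.geomFunctionField a)
      (algebraMap _ W.geomFunctionField b)
      ((Affine.baseChange_nonsingular (W := W) (f := Algebra.ofId _ _)
        (FaithfulSMul.algebraMap_injective _ _) a b).mpr h) :=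
  rfl

/-- `constPoint` is injective. [folklore] -/
theorem constPoint_injective : Function.Injective W.constPoint :=
  Affine.Point.map_injective _

/-- A `K̄`-algebra endomorphism of `K̄(E)` fixes the constant points. [folklore] -/
theorem map_constPoint (σ : W.geomFunctionField →ₐ[AlgebraicClosure K] W.geomFunctionField)
    (T : W.geomPoints) : Affine.Point.map (W' := W) σ (W.constPoint T) = W.constPoint T :=
  Affine.Point.map_baseChange (W' := W) σ T

/-- An element of `K̄(E)` algebraic over `K̄` is a constant (`K̄` is algebraically closed).
[folklore] -/
theorem exists_algebraMap_eq_of_isAlgebraic {u : W.geomFunctionField}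
    (hu : IsAlgebraic (AlgebraicClosure K) u) : ∃ a : AlgebraicClosure K, algebraMap _ _ a = u := by
  have h1 : (minpoly (AlgebraicClosure K) u).degree = 1 :=
    IsAlgClosed.degree_eq_one_of_irreducible _ (minpoly.irreducible hu.isIntegral)
  exact minpoly.mem_range_of_degree_eq_one _ _ h1

/-- **An affine point of `E(K̄(E))` with algebraic `x`-coordinate is constant** (its
`y`-coordinate is then a root of a monic quadratic over `K̄`). [folklore] -/
theorem exists_constPoint_eq_of_isAlgebraic {u v : W.geomFunctionField}
    (h : (W.baseChange W.geomFunctionField).toAffine.Nonsingular u v)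
    (hu : IsAlgebraic (AlgebraicClosure K) u) : ∃ T : W.geomPoints, W.constPoint T = .some u v h := by
  obtain ⟨a, rfl⟩ := exists_algebraMap_eq_of_isAlgebraic hu
  -- `v` is integral over `K̄`: it is a root of `W(a, Y)`, monic of degree two
  set q : (AlgebraicClosure K)[X] :=
    (W.baseChange (AlgebraicClosure K)).toAffine.polynomial.map (evalRingHom a) with hq
  have hqm : q.Monic :=
    (Affine.monic_polynomial (W := (W.baseChange (AlgebraicClosure K)).toAffine)).map _
  have hqv : aeval v q = 0 := by
    have he : (((W.baseChange (AlgebraicClosure K)).toAffine.polynomial.map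
        (mapRingHom (algebraMap (AlgebraicClosure K) W.geomFunctionField))).map
        (evalRingHom (algebraMap (AlgebraicClosure K) W.geomFunctionField a))).eval v = 0 := by
      rw [map_evalRingHom_eval, ← baseChange_geomFunctionField_polynomial]
      exact h.1
    have hcomp : (evalRingHom (algebraMap (AlgebraicClosure K) W.geomFunctionField a)).comp
        (mapRingHom (algebraMap (AlgebraicClosure K) W.geomFunctionField)) =
        (algebraMap (AlgebraicClosure K) W.geomFunctionField).comp (evalRingHom a) :=
      Polynomial.ringHom_ext (fun c ↦ by simp) (by simp)
    rw [Polynomial.map_map, hcomp, ← Polynomial.map_map] at he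
    rwa [aeval_def, eval₂_eq_eval_map]
  have hv : IsAlgebraic (AlgebraicClosure K) v := ⟨q, hqm.ne_zero, hqv⟩
  obtain ⟨b, rfl⟩ := exists_algebraMap_eq_of_isAlgebraic hv
  have hab : (W.baseChange (AlgebraicClosure K)).toAffine.Nonsingular a b :=
    (Affine.baseChange_nonsingular (W := W) (f := Algebra.ofId _ W.geomFunctionField)
      (FaithfulSMul.algebraMap_injective _ _) a b).mp h
  exact ⟨.some a b hab, rfl⟩

/-- An affine geometric point has coordinates. [folklore] -/
theorem geomPoints.exists_eq_some {P : W.geomPoints} (hP : P ≠ 0) :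
    ∃ x y h, P = (Affine.Point.some x y h : W.geomPoints) := by
  cases P with
  | zero => exact (hP rfl).elim
  | some x y h => exact ⟨x, y, h, rfl⟩

variable [W.IsElliptic]

/-- **The generic point is not a translate of a constant point by a constant point**; in
particular it is not constant (its `x`-coordinate is transcendental). [folklore] -/
theorem genericPoint_add_constPoint_ne (T S : W.geomPoints) :
    W.genericPoint + W.constPoint T ≠ W.constPoint S := by
  intro h
  have h' : W.genericPoint = W.constPoint (S - T) := by
    rw [map_sub]
    exact eq_sub_of_add_eq h
  by_cases hST : S - T = 0
  · rw [hST, map_zero] at h'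
    exact Affine.Point.some_ne_zero _ h'
  · obtain ⟨a, b, hab, e⟩ := geomPoints.exists_eq_some hST
    rw [e, constPoint_some] at h'
    have hx := (Affine.Point.some.inj h').1
    exact transcendental_genX W (hx ▸ isAlgebraic_algebraMap a)

/-- The translate of the generic point by a constant point is an affine point with transcendental
`x`-coordinate. [folklore] -/
theorem exists_genericPoint_add_constPoint_eq (T : W.geomPoints) :
    ∃ u v h, W.genericPoint + W.constPoint T = .some u v h ∧
      Transcendental (AlgebraicClosure K) u := by
  cases hQ : W.genericPoint + W.constPoint T with
  | zero => exact (genericPoint_add_constPoint_ne T 0 (by rw [hQ, map_zero]; rfl)).elim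
  | some u v h =>
    refine ⟨u, v, h, rfl, fun hu ↦ ?_⟩
    obtain ⟨S, hS⟩ := exists_constPoint_eq_of_isAlgebraic h hu
    exact genericPoint_add_constPoint_ne T S (hQ.trans hS.symm)

end Generic

/-! ## Translations of `K̄(E)` -/

section Translation

variable [W.IsElliptic]

/-- A `K̄`-algebra endomorphism `σ` of `K̄(E)` maps the generic point to `(σ x, σ y)`. [folklore] -/
theorem map_genericPoint (σ : W.geomFunctionField →ₐ[AlgebraicClosure K] W.geomFunctionField) :
    Affine.Point.map (W' := W) σ W.genericPoint = .some (σ W.genX) (σ W.genY)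
      ((Affine.baseChange_nonsingular (W := W) (A := W.geomFunctionField) (f := σ)
        σ.injective _ _).mpr (nonsingular_genX_genY W)) :=
  rfl

/-- **A `K̄`-algebra endomorphism of `K̄(E)` is determined by the image of the generic point.**
[folklore] -/
theorem algHom_eq_of_map_genericPoint_eq
    {σ τ : W.geomFunctionField →ₐ[AlgebraicClosure K] W.geomFunctionField}
    (h : Affine.Point.map (W' := W) σ W.genericPoint = Affine.Point.map (W' := W) τ W.genericPoint) :
    σ = τ := by
  rw [map_genericPoint, map_genericPoint] at h
  obtain ⟨hx, hy⟩ := Affine.Point.some.inj h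
  exact algHom_ext_xy hx hy

/-- **A point `Q ∈ E(K̄(E))` which is not a constant point is the image of the generic point under
a `K̄`-algebra endomorphism of `K̄(E)`** (unique by `algHom_eq_of_map_genericPoint_eq`): `Q` is
affine with transcendental `x`-coordinate, and the endomorphism is the point map `funcAlgHom` of
`Q`. Silverman, *AEC*, II.§2 (rational maps `E ⇢ E` and `K̄`-algebra maps `K̄(E) → K̄(E)`).
[folklore] -/
theorem exists_algHom_map_genericPoint_eq {Q : (W.baseChange W.geomFunctionField).toAffine.Point}
    (hQ : ∀ S : W.geomPoints, Q ≠ W.constPoint S) :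
    ∃ σ : W.geomFunctionField →ₐ[AlgebraicClosure K] W.geomFunctionField,
      Affine.Point.map (W' := W) σ W.genericPoint = Q := by
  cases Q with
  | zero => exact (hQ 0 (map_zero _).symm).elim
  | some u v h =>
    have hu : Transcendental (AlgebraicClosure K) u := fun hu ↦ by
      obtain ⟨S, hS⟩ := exists_constPoint_eq_of_isAlgebraic h hu
      exact hQ S hS.symm
    have he : ((W.baseChange (AlgebraicClosure K)).toAffine.polynomial.map
        (mapRingHom (algebraMap (AlgebraicClosure K) W.geomFunctionField))).evalEval u v = 0 := by
      rw [← baseChange_geomFunctionField_polynomial]; exact h.1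
    refine ⟨funcAlgHom u v he hu, ?_⟩
    rw [map_genericPoint]
    simp only [genX, genY, funcAlgHom_xF, funcAlgHom_yF]

variable (W) in
/-- **Translation by `T ∈ E(K̄)` on the function field**: the `K̄`-algebra endomorphism
`τ_T^* : K̄(E) → K̄(E)`, `f ↦ f ∘ τ_T` (`τ_T : P ↦ P + T`, Silverman, *AEC*, III.3.6 and proof of
III.4.10(b)), characterised by sending the generic point `(x, y)` to `(x, y) + T` in `E(K̄(E))`
(`map_transAlgHom_genericPoint`). [folklore] -/
def transAlgHom (T : W.geomPoints) : W.geomFunctionField →ₐ[AlgebraicClosure K] W.geomFunctionField :=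
  (exists_algHom_map_genericPoint_eq (genericPoint_add_constPoint_ne T)).choose

/-- `τ_T^*` maps the generic point to `(x, y) + T`. [folklore] -/
theorem map_transAlgHom_genericPoint (T : W.geomPoints) :
    Affine.Point.map (W' := W) (W.transAlgHom T) W.genericPoint =
      W.genericPoint + W.constPoint T :=
  (exists_algHom_map_genericPoint_eq (genericPoint_add_constPoint_ne T)).choose_spec

omit [W.IsElliptic] in
/-- The identity of `K̄(E)` fixes every point of `E(K̄(E))`. [folklore] -/
theorem map_algHom_id (Q : (W.baseChange W.geomFunctionField).toAffine.Point) :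
    Affine.Point.map (W' := W) (AlgHom.id (AlgebraicClosure K) W.geomFunctionField) Q = Q := by
  cases Q <;> rfl

/-- **`τ_O^* = id`.** [folklore] -/
theorem transAlgHom_zero : W.transAlgHom 0 = AlgHom.id _ _ :=
  algHom_eq_of_map_genericPoint_eq (by
    rw [map_transAlgHom_genericPoint, map_zero, map_algHom_id]
    exact add_zero _)

/-- **`τ_{S+T}^* = τ_S^* ∘ τ_T^*`** (`Affine.Point.map` is additive and fixes constant points, and
an endomorphism is determined by the image of the generic point). Silverman, *AEC*, proof of
Thm. III.4.10(b). [folklore] -/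
theorem transAlgHom_add (S T : W.geomPoints) :
    W.transAlgHom (S + T) = (W.transAlgHom S).comp (W.transAlgHom T) := by
  refine algHom_eq_of_map_genericPoint_eq ?_
  rw [← Affine.Point.map_map, map_transAlgHom_genericPoint T, map_add,
    map_transAlgHom_genericPoint S, map_constPoint, map_transAlgHom_genericPoint (S + T), map_add]
  exact (add_assoc _ _ _).symm

/-- `τ_T^* ∘ τ_{-T}^* = id`. [folklore] -/
theorem transAlgHom_comp_neg (T : W.geomPoints) :
    (W.transAlgHom T).comp (W.transAlgHom (-T)) = AlgHom.id _ _ := by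
  rw [← transAlgHom_add, add_neg_cancel, transAlgHom_zero]

variable (W) in
/-- **Translation by `T` as a `K̄`-algebra automorphism of `K̄(E)`** (inverse `τ_{-T}^*`).
Silverman, *AEC*, III.3.6, proof of Thm. III.4.10(b). [folklore] -/
def transAlgEquiv (T : W.geomPoints) : W.geomFunctionField ≃ₐ[AlgebraicClosure K] W.geomFunctionField :=
  AlgEquiv.ofAlgHom (W.transAlgHom T) (W.transAlgHom (-T)) (transAlgHom_comp_neg T)
    (by simpa using transAlgHom_comp_neg (-T))

/-- `transAlgEquiv` acts as `transAlgHom`. [folklore] -/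
@[simp] theorem transAlgEquiv_apply (T : W.geomPoints) (z : W.geomFunctionField) :
    W.transAlgEquiv T z = W.transAlgHom T z :=
  rfl

variable (W) in
/-- **The translation homomorphism `E(K̄) → Aut(K̄(E)/K̄)`, `T ↦ τ_T^*`.** Silverman, *AEC*,
proof of Thm. III.4.10(b). [folklore] -/
def transHom : Multiplicative W.geomPoints →* (W.geomFunctionField ≃ₐ[AlgebraicClosure K]
    W.geomFunctionField) where
  toFun T := W.transAlgEquiv T.toAdd
  map_one' := by
    refine AlgEquiv.ext fun z ↦ ?_
    simp [transAlgHom_zero]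
  map_mul' S T := by
    refine AlgEquiv.ext fun z ↦ ?_
    simp [toAdd_mul, transAlgHom_add]

/-- `transHom` acts as `transAlgHom`. [folklore] -/
@[simp] theorem transHom_apply (T : Multiplicative W.geomPoints) (z : W.geomFunctionField) :
    W.transHom T z = W.transAlgHom T.toAdd z :=
  rfl

/-- **`T ↦ τ_T^*` is injective** (`τ_T^* = id` forces `(x, y) + T = (x, y)`). Silverman, *AEC*,
proof of Thm. III.4.10(b) ("`τ_T^*` ... distinct elements"). [folklore] -/
theorem transHom_injective : Function.Injective W.transHom := by
  intro S T hST
  have h : W.transAlgHom S.toAdd = W.transAlgHom T.toAdd :=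
    AlgHom.ext fun z ↦ by simpa using congrArg (fun e ↦ e z) hST
  have := congrArg (fun σ ↦ Affine.Point.map (W' := W) σ W.genericPoint) h
  simp only [map_transAlgHom_genericPoint, add_right_inj] at this
  exact Multiplicative.toAdd.injective (constPoint_injective this)

end Translation

/-! ## Values of translated functions: `(τ_T^* z)(P) = z(P + T)` -/

section TranslationValues

variable {P T : W.geomPoints} {z : W.geomFunctionField} {c : AlgebraicClosure K}

/-- The coefficient `a₁` of `E` over `K̄(E)` has value `a₁`. [folklore] -/
theorem hasValueAt_a₁ (P : W.geomPoints) : W.HasValueAt (W.baseChange W.geomFunctionField).a₁ P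
    (W.baseChange (AlgebraicClosure K)).a₁ := by
  simpa [IsScalarTower.algebraMap_apply K (AlgebraicClosure K) W.geomFunctionField] using
    hasValueAt_algebraMap (W := W) (algebraMap K (AlgebraicClosure K) W.a₁) P

/-- The coefficient `a₂` of `E` over `K̄(E)` has value `a₂`. [folklore] -/
theorem hasValueAt_a₂ (P : W.geomPoints) : W.HasValueAt (W.baseChange W.geomFunctionField).a₂ P
    (W.baseChange (AlgebraicClosure K)).a₂ := by
  simpa [IsScalarTower.algebraMap_apply K (AlgebraicClosure K) W.geomFunctionField] using
    hasValueAt_algebraMap (W := W) (algebraMap K (AlgebraicClosure K) W.a₂) P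

/-- The coefficient `a₃` of `E` over `K̄(E)` has value `a₃`. [folklore] -/
theorem hasValueAt_a₃ (P : W.geomPoints) : W.HasValueAt (W.baseChange W.geomFunctionField).a₃ P
    (W.baseChange (AlgebraicClosure K)).a₃ := by
  simpa [IsScalarTower.algebraMap_apply K (AlgebraicClosure K) W.geomFunctionField] using
    hasValueAt_algebraMap (W := W) (algebraMap K (AlgebraicClosure K) W.a₃) P

variable {x₁ x₂ y₁ y₂ L : W.geomFunctionField} {c₁ c₂ d₁ d₂ ℓ : AlgebraicClosure K}

/-- Values of `negY`. [folklore] -/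
theorem HasValueAt.negY (hx : W.HasValueAt x₁ P c₁) (hy : W.HasValueAt y₁ P d₁) :
    W.HasValueAt ((W.baseChange W.geomFunctionField).toAffine.negY x₁ y₁) P
      ((W.baseChange (AlgebraicClosure K)).toAffine.negY c₁ d₁) := by
  simp only [Affine.negY]
  exact (hy.neg.sub ((hasValueAt_a₁ P).mul hx)).sub (hasValueAt_a₃ P)

/-- Values of `addX`. [folklore] -/
theorem HasValueAt.addX (h₁ : W.HasValueAt x₁ P c₁) (h₂ : W.HasValueAt x₂ P c₂)
    (hL : W.HasValueAt L P ℓ) :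
    W.HasValueAt ((W.baseChange W.geomFunctionField).toAffine.addX x₁ x₂ L) P
      ((W.baseChange (AlgebraicClosure K)).toAffine.addX c₁ c₂ ℓ) := by
  simp only [Affine.addX]
  exact ((((hL.pow 2).add ((hasValueAt_a₁ P).mul hL)).sub (hasValueAt_a₂ P)).sub h₁).sub h₂

/-- Values of `negAddY`. [folklore] -/
theorem HasValueAt.negAddY (h₁ : W.HasValueAt x₁ P c₁) (h₂ : W.HasValueAt x₂ P c₂)
    (hy : W.HasValueAt y₁ P d₁) (hL : W.HasValueAt L P ℓ) :
    W.HasValueAt ((W.baseChange W.geomFunctionField).toAffine.negAddY x₁ x₂ y₁ L) P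
      ((W.baseChange (AlgebraicClosure K)).toAffine.negAddY c₁ c₂ d₁ ℓ) := by
  simp only [Affine.negAddY]
  exact (hL.mul ((h₁.addX h₂ hL).sub h₁)).add hy

/-- Values of `addY`. [folklore] -/
theorem HasValueAt.addY (h₁ : W.HasValueAt x₁ P c₁) (h₂ : W.HasValueAt x₂ P c₂)
    (hy : W.HasValueAt y₁ P d₁) (hL : W.HasValueAt L P ℓ) :
    W.HasValueAt ((W.baseChange W.geomFunctionField).toAffine.addY x₁ x₂ y₁ L) P
      ((W.baseChange (AlgebraicClosure K)).toAffine.addY c₁ c₂ d₁ ℓ) :=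
  (h₁.addX h₂ hL).negY (h₁.negAddY h₂ hy hL)

/-- Values of the slope of a chord (`x`-coordinates with distinct values). [folklore] -/
theorem HasValueAt.slope (hP : P ≠ 0) (h₁ : W.HasValueAt x₁ P c₁) (h₂ : W.HasValueAt x₂ P c₂)
    (hy₁ : W.HasValueAt y₁ P d₁) (hy₂ : W.HasValueAt y₂ P d₂) (hc : c₁ ≠ c₂) :
    W.HasValueAt ((W.baseChange W.geomFunctionField).toAffine.slope x₁ x₂ y₁ y₂) P
      ((W.baseChange (AlgebraicClosure K)).toAffine.slope c₁ c₂ d₁ d₂) := by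
  have hx : x₁ ≠ x₂ := fun h ↦ hc (h₁.unique hP (h ▸ h₂))
  rw [Affine.slope_of_X_ne hx, Affine.slope_of_X_ne hc]
  exact (hy₁.sub hy₂).div hP (h₁.sub h₂) (sub_ne_zero.mpr hc)

/-- Values of `MvPolynomial.aeval`. [folklore] -/
theorem HasValueAt.aeval {w : Fin 2 → W.geomFunctionField} {e : Fin 2 → AlgebraicClosure K}
    (hw : ∀ i, W.HasValueAt (w i) P (e i)) (g : MvPolynomial (Fin 2) (AlgebraicClosure K)) :
    W.HasValueAt (MvPolynomial.aeval w g) P (MvPolynomial.eval e g) := by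
  induction g using MvPolynomial.induction_on with
  | C a => simpa using hasValueAt_algebraMap (W := W) a P
  | add p q hp hq => simpa using hp.add hq
  | mul_X p i hp => simpa using hp.mul (hw i)

/-- `x` has value `x(P)` and `y` has value `y(P)`. [folklore] -/
theorem hasValueAt_gen (P : W.geomPoints) (i : Fin 2) : W.HasValueAt (![W.genX, W.genY] i) P (xy P i) := by
  fin_cases i
  · simpa using hasValueAt_evalGeneric (W := W) (MvPolynomial.X 0) P
  · simpa using hasValueAt_evalGeneric (W := W) (MvPolynomial.X 1) P

variable [W.IsElliptic]

/-- **`τ_T^* x` and `τ_T^* y` have values `x(P + T)`, `y(P + T)` at `P`** (for `P ≠ O, ±T`: the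
chord through the generic point and `T` specialises to the chord through `P` and `T`).
Silverman, *AEC*, III.2.3 (the group law is given by rational functions). [folklore] -/
theorem hasValueAt_transAlgHom_gen (hP : P ≠ 0) (hPT : P ≠ T) (hPT' : P + T ≠ 0) (i : Fin 2) :
    W.HasValueAt (![W.transAlgHom T W.genX, W.transAlgHom T W.genY] i) P (xy (P + T) i) := by
  -- the case `T = O`
  rcases eq_or_ne T 0 with rfl | hT
  · simpa [transAlgHom_zero] using hasValueAt_gen P i
  -- coordinates
  obtain ⟨x₀, y₀, hP₀, hPe⟩ := geomPoints.exists_eq_some hP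
  obtain ⟨a, b, hab, hTe⟩ := geomPoints.exists_eq_some hT
  have hxa : x₀ ≠ a := fun h ↦ by
    rcases (Affine.Point.X_eq_iff (h₁ := hP₀) (h₂ := hab)).mp h with h' | h'
    · exact hPT (by rw [hPe, hTe]; exact h')
    · apply hPT'
      rw [add_eq_zero_iff_eq_neg, hPe, hTe]
      exact h'
  -- the sum `P + T` over `K̄`
  have hsum : P + T = (Affine.Point.some _ _
      (Affine.nonsingular_add hP₀ hab fun h ↦ hxa h.1) : W.geomPoints) := by
    rw [hPe, hTe]
    exact Affine.Point.add_of_X_ne hxa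
  -- the sum `(x, y) + T` over `K̄(E)`
  set F := W.geomFunctionField
  have hxa' : W.genX ≠ algebraMap (AlgebraicClosure K) F a := fun h ↦
    transcendental_genX W (h ▸ isAlgebraic_algebraMap a)
  have hsum' : W.genericPoint + W.constPoint T =
      Affine.Point.some _ _ (Affine.nonsingular_add (nonsingular_genX_genY W)
        ((Affine.baseChange_nonsingular (W := W) (f := Algebra.ofId _ _)
          (FaithfulSMul.algebraMap_injective _ _) a b).mpr hab) fun h ↦ hxa' h.1) := by
    rw [hTe, constPoint_some]
    exact Affine.Point.add_of_X_ne hxa'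
  have hmap := map_transAlgHom_genericPoint (W := W) T
  rw [hsum', map_genericPoint] at hmap
  obtain ⟨hx, hy⟩ := Affine.Point.some.inj hmap
  -- values
  have hxyP : xy P = ![x₀, y₀] := by rw [hPe, xy_some]
  have hvx : W.HasValueAt W.genX P x₀ := by simpa [hxyP] using hasValueAt_gen (W := W) P 0
  have hvy : W.HasValueAt W.genY P y₀ := by simpa [hxyP] using hasValueAt_gen (W := W) P 1
  have hva := hasValueAt_algebraMap (W := W) a P
  have hvb := hasValueAt_algebraMap (W := W) b P
  have hvL := hvx.slope hP hva hvy hvb hxa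
  rw [hsum, xy_some]
  fin_cases i
  · simp only [Fin.zero_eta, Fin.isValue, Matrix.cons_val_zero]
    rw [hx]
    exact hvx.addX hva hvL
  · simp only [Fin.mk_one, Fin.isValue, Matrix.cons_val_one, Matrix.cons_val_zero]
    rw [hy]
    exact hvx.addY hva hvy hvL

/-- **`(τ_T^* g(x, y))(P) = g(P + T)`** for a polynomial `g`. [folklore] -/
theorem hasValueAt_transAlgHom_evalGeneric (hP : P ≠ 0) (hPT : P ≠ T) (hPT' : P + T ≠ 0)
    (g : MvPolynomial (Fin 2) (AlgebraicClosure K)) :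
    W.HasValueAt (W.transAlgHom T (W.evalGeneric g)) P (MvPolynomial.eval (xy (P + T)) g) := by
  rw [algHom_evalGeneric]
  exact HasValueAt.aeval (hasValueAt_transAlgHom_gen hP hPT hPT') g

/-- **`(τ_T^* z)(P) = z(P + T)`**: if `z ∈ K̄(E)` has value `c` at `P + T` then `τ_T^* z` has value
`c` at `P` (`P ≠ O, ±T`). Silverman, *AEC*, II.§2 (`φ^* f = f ∘ φ`), III.3.6. [folklore] -/
theorem HasValueAt.transAlgHom (hP : P ≠ 0) (hPT : P ≠ T) (hPT' : P + T ≠ 0)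
    (h : W.HasValueAt z (P + T) c) : W.HasValueAt (W.transAlgHom T z) P c := by
  obtain ⟨g, h, hh, hz, hg⟩ := h
  have hvh := hasValueAt_transAlgHom_evalGeneric hP hPT hPT' h (T := T)
  have hvg := hasValueAt_transAlgHom_evalGeneric hP hPT hPT' g (T := T)
  have hne : W.transAlgHom T (W.evalGeneric h) ≠ 0 := hvh.ne_zero hP hh
  have hz' : W.transAlgHom T z = W.transAlgHom T (W.evalGeneric g) /
      W.transAlgHom T (W.evalGeneric h) := by
    rw [eq_div_iff hne, ← map_mul, hz]
  rw [hz']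
  refine (hvg.div hP hvh hh).congr rfl ?_
  rw [hg, mul_div_cancel_right₀ _ hh]

end TranslationValues

/-! ## Kernel translations fix `φ^* K̄(E')`; `#ker φ ∣ deg φ` -/

section Kernel

/-- The finite set of points to avoid in the translation argument for `φ` and `T`: the
exceptional set `B` of the rational representation of `φ`, its translate `B - T`, and `O, T, -T`.
[folklore] -/
theorem Isogeny.finite_badSet (φ : Isogeny W W') (T : W.geomPoints) :
    ({P : W.geomPoints | ¬ AgreesWithRationalMapAt W W' φ.rationalRep.P₁ φ.rationalRep.Q₁
        φ.rationalRep.P₂ φ.rationalRep.Q₂ φ P} ∪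
      (fun Q ↦ Q - T) '' {P : W.geomPoints | ¬ AgreesWithRationalMapAt W W' φ.rationalRep.P₁
        φ.rationalRep.Q₁ φ.rationalRep.P₂ φ.rationalRep.Q₂ φ P} ∪ {0, T, -T}).Finite :=
  ((φ.rationalRep.finite.union (φ.rationalRep.finite.image _)).union (by simp))

variable [W.IsElliptic]

/-- **Translations by kernel points fix `φ^* x'`**: for `T ∈ ker φ`, `τ_T^* (φ^* x') = φ^* x'`
(both have value `x'(φ(P + T)) = x'(φ P)` at all but finitely many `P`). Silverman, *AEC*, proof
of Thm. III.4.10(b) (`τ_T^* ∘ φ^* = (φ ∘ τ_T)^* = φ^*`). [folklore] -/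
theorem Isogeny.transAlgHom_pullbackX (φ : Isogeny W W') {T : W.geomPoints} (hT : φ T = 0) :
    W.transAlgHom T φ.pullbackX = φ.pullbackX := by
  set r := φ.rationalRep with hr
  apply eq_of_infinite_setOf_hasValueAt
  refine ((φ.finite_badSet T).infinite_compl).mono ?_
  intro P hP
  simp only [Set.mem_compl_iff, Set.mem_union, Set.mem_setOf_eq, Set.mem_image, Set.mem_insert_iff,
    Set.mem_singleton_iff, not_or, not_not, not_exists, not_and] at hP
  obtain ⟨⟨hPB, hPTB⟩, hP0, hPT, hPnT⟩ := hP
  have hPTB' : AgreesWithRationalMapAt W W' r.P₁ r.Q₁ r.P₂ r.Q₂ φ (P + T) := by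
    by_contra h
    exact hPTB (P + T) h (add_sub_cancel_right P T)
  have hPT' : P + T ≠ 0 := fun h ↦ hPnT (add_eq_zero_iff_eq_neg.mp h)
  obtain ⟨-, hQ₁, -, h', e⟩ := agreesWithRationalMapAt_iff.mp hPB
  obtain ⟨hPT0, hQ₁', -, h'', e'⟩ := agreesWithRationalMapAt_iff.mp hPTB'
  have heq : φ (P + T) = φ P := by rw [map_add, hT, add_zero]
  rw [e, e'] at heq
  obtain ⟨hxx, -⟩ := Affine.Point.some.inj heq
  refine ⟨hP0, _, ?_, hasValueAt_div hP0 hQ₁⟩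
  exact ((hasValueAt_div hPT0 hQ₁').transAlgHom hP0 hPT hPT').congr rfl hxx

/-- **Translations by kernel points fix `φ^* y'`.** Silverman, *AEC*, proof of Thm. III.4.10(b).
[folklore] -/
theorem Isogeny.transAlgHom_pullbackY (φ : Isogeny W W') {T : W.geomPoints} (hT : φ T = 0) :
    W.transAlgHom T φ.pullbackY = φ.pullbackY := by
  set r := φ.rationalRep with hr
  apply eq_of_infinite_setOf_hasValueAt
  refine ((φ.finite_badSet T).infinite_compl).mono ?_
  intro P hP
  simp only [Set.mem_compl_iff, Set.mem_union, Set.mem_setOf_eq, Set.mem_image, Set.mem_insert_iff,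
    Set.mem_singleton_iff, not_or, not_not, not_exists, not_and] at hP
  obtain ⟨⟨hPB, hPTB⟩, hP0, hPT, hPnT⟩ := hP
  have hPTB' : AgreesWithRationalMapAt W W' r.P₁ r.Q₁ r.P₂ r.Q₂ φ (P + T) := by
    by_contra h
    exact hPTB (P + T) h (add_sub_cancel_right P T)
  have hPT' : P + T ≠ 0 := fun h ↦ hPnT (add_eq_zero_iff_eq_neg.mp h)
  obtain ⟨-, -, hQ₂, h', e⟩ := agreesWithRationalMapAt_iff.mp hPB
  obtain ⟨hPT0, -, hQ₂', h'', e'⟩ := agreesWithRationalMapAt_iff.mp hPTB'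
  have heq : φ (P + T) = φ P := by rw [map_add, hT, add_zero]
  rw [e, e'] at heq
  obtain ⟨-, hyy⟩ := Affine.Point.some.inj heq
  refine ⟨hP0, _, ?_, hasValueAt_div hP0 hQ₂⟩
  exact ((hasValueAt_div hPT0 hQ₂').transAlgHom hP0 hPT hPT').congr rfl hyy

/-- **`ker φ` acts on `K̄(E)` over `φ^* K̄(E')`**: the subgroup `{τ_T^* : T ∈ ker φ}` of
`Aut(K̄(E)/K̄)` fixes `φ^* K̄(E')` pointwise. Silverman, *AEC*, proof of Thm. III.4.10(b).
[folklore] -/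
theorem Isogeny.pullbackField_le_fixedField (φ : Isogeny W W') :
    φ.pullbackField ≤ IntermediateField.fixedField
      ((AddSubgroup.toSubgroup φ.toAddMonoidHom.ker).map W.transHom) := by
  rw [Isogeny.pullbackField, IntermediateField.adjoin_le_iff]
  rintro z hz
  rw [SetLike.mem_coe, IntermediateField.mem_fixedField_iff]
  rintro f hf
  obtain ⟨g, hg, rfl⟩ := Subgroup.mem_map.mp hf
  have hg' : φ g.toAdd = 0 := by simpa using hg
  rcases hz with rfl | hz
  · exact φ.transAlgHom_pullbackX hg'
  · rw [Set.mem_singleton_iff.mp hz]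
    exact φ.transAlgHom_pullbackY hg'

/-- **`#ker φ ∣ deg φ`** for every isogeny `φ : E → E'` of elliptic curves over `K`
(unconditionally, over the genuine degree `deg φ = [K̄(E) : φ^* K̄(E')]` of `IsogenyDegree`): the
`#ker φ` automorphisms `τ_T^*`, `T ∈ ker φ`, of `K̄(E)` are distinct and fix `φ^* K̄(E')`, so by
Artin's theorem `[K̄(E) : K̄(E)^{ker φ}] = #ker φ` divides `[K̄(E) : φ^* K̄(E')]`. This is the part of
Silverman, *AEC*, Thm. III.4.10 (`#ker φ = deg_s φ ∣ deg φ`) consumed by the degree route to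
Thm. III.7.4 (`Literature.AlgebraicGeometry.Motives.linearIndependent_tateModule_map_of_card_ker_dvd_deg`).
[cite: SilvermanAEC2009, Thm. III.4.10(a),(b) (proof)] -/
theorem Isogeny.card_ker_dvd_deg_holds (φ : Isogeny W W') :
    Nat.card φ.toAddMonoidHom.ker ∣ φ.deg := by
  set H : Subgroup (W.geomFunctionField ≃ₐ[AlgebraicClosure K] W.geomFunctionField) :=
    (AddSubgroup.toSubgroup φ.toAddMonoidHom.ker).map W.transHom with hH
  have hcardK : Nat.card (AddSubgroup.toSubgroup φ.toAddMonoidHom.ker) =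
      Nat.card φ.toAddMonoidHom.ker :=
    Nat.card_congr (Equiv.subtypeEquiv Multiplicative.toAdd fun _ ↦ Iff.rfl)
  have hcard : Nat.card H = Nat.card φ.toAddMonoidHom.ker := by
    rw [hH, Subgroup.card_map_of_injective transHom_injective, hcardK]
  haveI : Finite (AddSubgroup.toSubgroup φ.toAddMonoidHom.ker) :=
    Nat.finite_of_card_ne_zero (by
      rw [hcardK]; exact (Nat.card_pos (α := φ.toAddMonoidHom.ker)).ne')
  haveI : Finite H := by
    rw [hH]
    exact Finite.of_surjective _ (Subgroup.equivMapOfInjective _ _ transHom_injective).surjective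
  letI : Fintype H := Fintype.ofFinite H
  have h1 : Module.finrank (IntermediateField.fixedField H) W.geomFunctionField = Fintype.card H :=
    FixedPoints.finrank_eq_card H W.geomFunctionField
  rw [← hcard, Nat.card_eq_fintype_card, ← h1]
  exact IntermediateField.finrank_dvd_of_le_left φ.pullbackField_le_fixedField

end Kernel

end WeierstrassCurve
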